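import Literature.AlgebraicGeometry.HodgeTheory.AbelianVarietyHodgeEssentialImageRecord
import Literature.AlgebraicGeometry.HodgeTheory.BettiUniverseTraceIntegralHolomorphic
import HarnessLib

/-!
# `H¹_B(A)` does not depend on the Hodge model: the record avatar (γ) IS the universe avatar (α)

Family `hodge`, layer `Literature/AlgebraicGeometry/HodgeTheory`. Theorems only; no definition, no named fact.

The tree states facts about the weight-one `ℚ`-Hodge structure `H¹(A(ℂ); ℚ)` of a complex abelian variety `A` on
two binder forms:

* (α) `BettiUniverse.hodge hHD hX 1` (`HodgeTheory/BettiUniverseAxioms`): weight `((1 : ℕ) : ℤ)`, read in the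
  CHOSEN real model `realHodgeModel hHD hX` for `hX : IsSmoothProjective n X` — the form the axiomatic consumers
  (`Universe`-style binders, `BettiUniverseCMAction`, `BettiUniverseCMTypes`) use;
* (γ) `bettiOneHodgeStructure A B hB` (`HodgeTheory/AbelianVarietyHodgeEssentialImageRecord`, Deligne–Milne 1982
  Thm. 6.20): weight `1`, read in ANY Hodge-symmetric model `B : HodgeModel A.dim A.X` at the theorem
  `AbelianVariety.isSmoothProjective_holds` — the form the Riemann records (`DeligneMilne1982_Thm_6_20_essImage`,
  `isPolarizable_bettiOneHodgeStructure`) use.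

This file proves that they are THE SAME Hodge structure (`bettiOneHodgeStructure_eq_cast_hodge`,
`BettiUniverse.hodge_one_eq_cast_bettiOneHodgeStructure`), granted the model-independence of the Hodge type of a
class `hI : hodgePQ_independent_of_hodgeModel` (a theorem of the tree, `hodgePQ_independent_of_hodgeModel_holds`;
Voisin I Prop. 6.11: the pieces `Θ_B⁻¹(H^{p,q})`, hence the filtration `Θ_B⁻¹(F)`, do not depend on `B` —
`HodgeModel.ratF_eq_of_independent`), so that a record typed on (γ) serves an (α)-consumer and conversely; and that
(γ) does not depend on `B` (`bettiOneHodgeStructure_eq_of_independent`).  Also recorded, for (α)-consumers: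
`BettiUniverse.hodge_isPolarizable` — every `BettiUniverse.hodge hHD hX k` is polarisable (the tree's theorem
`smoothProjective_hodgeStructure_isPolarizable_holds`, Hodge–Riemann, read in the chosen real model).

## References

* [VoisinHodgeI2002] C. Voisin, Hodge Theory and Complex Algebraic Geometry I (CUP 2002), §6.1.3 Prop. 6.11,
  §7.1.1 Def. 7.4, §7.1.2 (polarisations; Thm. 6.32).
* [DeligneMilne1982Tannakian] P. Deligne, J. Milne, Tannakian categories, LNM 900 (1982), art. II §6 Thm. 6.20.
-/

noncomputable section

open CategoryTheory
open Literature.AlgebraicGeometry.Motives (AbelianVariety IsSmoothProjective)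

namespace Literature.AlgebraicGeometry.HodgeTheory

/-- **(γ) does not depend on the model**: `H¹_B(A) = H¹_{B'}(A)` for any two Hodge-symmetric Hodge models of `A`
(the filtrations `Θ_B⁻¹(F) = Θ_{B'}⁻¹(F)` agree, `HodgeModel.ratF_eq_of_independent`).
[cite: VoisinHodgeI2002, §6.1.3 Prop. 6.11 and §7.1.1 Def. 7.4] -/
theorem bettiOneHodgeStructure_eq_of_independent (hI : hodgePQ_independent_of_hodgeModel) (A : AbelianVariety ℂ)
    (B B' : HodgeModel A.dim A.X) (hB : B.IsHodgeSymmetric) (hB' : B'.IsHodgeSymmetric) :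
    bettiOneHodgeStructure A B hB = bettiOneHodgeStructure A B' hB' := by
  apply Motives.HodgeStructure.ext
  funext p
  rw [bettiOneHodgeStructure, bettiOneHodgeStructure, Motives.HodgeStructure.cast_F, Motives.HodgeStructure.cast_F,
    HodgeModel.hodgeStructure_F, HodgeModel.hodgeStructure_F,
    HodgeModel.ratF_eq_of_independent hI AbelianVariety.isSmoothProjective_holds B B' 1 p]

/-- **(γ) = (α)**: the record avatar `H¹_B(A)` (any Hodge-symmetric model `B`, weight `1`) IS the universe avatar
`BettiUniverse.hodge hHD hA 1` (chosen real model, weight `((1 : ℕ) : ℤ)`) transported along `Nat.cast_one`, for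
every `hA : IsSmoothProjective A.dim A.X`. [cite: VoisinHodgeI2002, §6.1.3 Prop. 6.11 and §7.1.1 Def. 7.4] -/
theorem bettiOneHodgeStructure_eq_cast_hodge (hHD : exists_isReal_hodgeModel)
    (hI : hodgePQ_independent_of_hodgeModel) (A : AbelianVariety ℂ) (B : HodgeModel A.dim A.X)
    (hB : B.IsHodgeSymmetric) (hA : IsSmoothProjective A.dim A.X) :
    bettiOneHodgeStructure A B hB = (BettiUniverse.hodge hHD hA 1).cast Nat.cast_one := by
  apply Motives.HodgeStructure.ext
  funext p
  rw [bettiOneHodgeStructure, Motives.HodgeStructure.cast_F, Motives.HodgeStructure.cast_F,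
    HodgeModel.hodgeStructure_F]
  exact (BettiUniverse.hodge_F_eq_ratF hHD hI hA B 1 p).symm

/-- **(α) = (γ)**, the direction an (α)-consumer rewrites with: `BettiUniverse.hodge hHD hA 1` is `H¹_B(A)`
transported back to weight `((1 : ℕ) : ℤ)`, for ANY Hodge-symmetric model `B`.
[cite: VoisinHodgeI2002, §6.1.3 Prop. 6.11 and §7.1.1 Def. 7.4] -/
theorem BettiUniverse.hodge_one_eq_cast_bettiOneHodgeStructure (hHD : exists_isReal_hodgeModel)
    (hI : hodgePQ_independent_of_hodgeModel) (A : AbelianVariety ℂ) (hA : IsSmoothProjective A.dim A.X)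
    (B : HodgeModel A.dim A.X) (hB : B.IsHodgeSymmetric) :
    BettiUniverse.hodge hHD hA 1 = (bettiOneHodgeStructure A B hB).cast Nat.cast_one.symm := by
  rw [bettiOneHodgeStructure_eq_cast_hodge hHD hI A B hB hA]
  apply Motives.HodgeStructure.ext
  funext p
  rw [Motives.HodgeStructure.cast_F, Motives.HodgeStructure.cast_F]

/-- **Every `BettiUniverse.hodge hHD hX k` is polarisable** (Hodge–Riemann bilinear relations for the compact Kähler
manifold `X^an`: the tree's theorem `smoothProjective_hodgeStructure_isPolarizable_holds`, read in the chosen real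
model). [cite: VoisinHodgeI2002, §7.1.2 and Thm. 6.32] -/
theorem BettiUniverse.hodge_isPolarizable (hHD : exists_isReal_hodgeModel) {n : ℕ} {X : Motives.SchemeOver ℂ}
    (hX : IsSmoothProjective n X) (k : ℕ) : (BettiUniverse.hodge hHD hX k).IsPolarizable :=
  smoothProjective_hodgeStructure_isPolarizable_holds hX (BettiUniverse.realHodgeModel hHD hX)
    (BettiUniverse.realHodgeModel_isHodgeSymmetric hHD hX) k

end Literature.AlgebraicGeometry.HodgeTheory

end
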